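import Mathlib
import HarnessLib
import Summits.HubbardSuperconductivity.HubbardSuperconductivity.Theorems.KLProgrammeKLRegimeTwoVolumeDualDefectPinned

/-!
# Route `KLProgramme` — crux K3 ENGINE (stmt-HubbardSuperconductivity-20437 `KLRegimeEngineV17F2`), stub (e) `stub_twoLeg_step` (row f072b1d12e7a):
# located item «(e)-D-ROWS» (pen (R348)), file F-D1 — the READ-OUT INTERFACE of the two-volume (D) rows `hdualSp` / `hdualCut`
# (cell gate-hubbard-kl, seat hubbard-kl-k3c4-p1 g21, VL lane by technique «FST2 volume lemmas»; blueprint HOME/hubbard-kl-k3c4-p1/DROWS-SCOPE-g21.md §5)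

The (e) closer of record `EngineV8.stub_twoLeg_step_of_gridBinderC_dualRows_raise_thr_G` (p609934) is modulo the two-volume rows `hdualSp` (nested volumes
`L₁ ∣ L₂`, common cutoff `M₂`) and `hdualCut` (one volume, two cutoffs `M₁ ≤ M₂`): at SOME pins, for the reading strings `m ∈ {ω₀, −ω₀}`, `σ : Fin 2`, the
`ε`-weighted sums of the PHASE-WEIGHTED time rows `R(o; y) = Σ_{t₁} W(o, (t₁, o⃗ + y))·e^{iω(t₀ − t₁)}` of the position-space two-leg kernels
`W = sectorisedKernel … (trivialMultiplier …) (𝒱^{(n')}[K_{n'}] − 𝒩_{K_{n'}}) 2 ((0,σ),0),((0,σ),1))` — defect through the centred lift `≤ Dd/L₁`, far fine rows `≤ Df/L₁`,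
two-cutoff defect `≤ Dc/L₁` (k3c5-p2's `hdual` texts, p558016/p558504).  The two-volume Lipschitz tower ((M1)–(M7)) delivers PINNED, PHASE-FREE, TIME-SUMMED
two-leg defects.  This file is the interface between the two (zero analysis; `|e^{iθ}| = 1`, sum the times first — k3c5-p3's `norm_phaseRow_sub_le` /
`norm_phaseRow_le`, here for BOTH offset signs `±y` exactly as the rows are typed):

* **`dualSpRows_le_of_pinnedDefect`** — generic kernels `Wc`, `Wf`, pins with a common time coordinate, any frequency index: the `hdualSp` defect row
  `≤ Σ_{t₁} Σ_ȳ (‖Wc(oc,(t₁,o⃗c+ȳ)) − Wf(of,(t₁,o⃗f+ȳ↑))‖ + ‖Wc(oc,(t₁,o⃗c−ȳ)) − Wf(of,(t₁,o⃗f−ȳ↑))‖)` and the far row `≤ Σ_{t₁} Σ_{y far} (‖Wf(of,(t₁,o⃗f+y))‖ + ‖Wf(of,(t₁,o⃗f−y))‖)`;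
* **`dualCutRows_le_of_pinnedDefect`** — the `hdualCut` row (two cutoffs `M₁`, `M₂`, the `ε`'s inside the norms): `≤ Σ_y (ε₁·Σ_{t₁}‖W₁(o₁,(t₁,o⃗₁±y))‖-type` … no: the
  two-cutoff row compares DIFFERENT time grids, so the phase cannot be dropped termwise; the interface there is the triangle
  `‖ε₁R₁ − ε₂R₂‖ ≤ ‖ε₁R₁ − A‖ + ‖A − ε₂R₂‖` through any common comparison value `A` (the tower's continuum-time / common-grid reading) — stated as
  `dualCutRow_le_of_common`;
* **`hdualSp_point_of_pinnedDefect`** — the MODEL-keyed corollary at one `(n', L₁, L₂, M₂)`: from pins `(oc, of)` with `of.1 = oc.1` and per-`σ` pinned bounds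
  `Σ_{t₁}Σ_ȳ(…) ≤ Pd σ`, `Σ_{t₁}Σ_{y far}(…) ≤ Pf σ` with `ε·Pd σ ≤ Dd/L₁`, `ε·Pf σ ≤ Df/L₁` — EXACTLY the body of `hdualSp`'s `∃ (oc) (of), …` at those pins.
Pure bookkeeping; nothing about the model is asserted; nothing asserts the (D) rows, (e), any stub, VL, K3 or superconductivity.
References: BGM 2006 §2.4 (2.38) [cite: BenfattoGiulianiMastropietro2006].
-/

noncomputable section

namespace Summit.HubbardSuperconductivity.HubbardSuperconductivity.Theorems.TwoVolumeDefect

set_option linter.dupNamespace false -- summit = problem name (single-conjunct summit), D-0017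

open Finset Complex Literature.MathematicalPhysics.QuantumLattice Literature.Probability.LatticeModels GrassmannAlgebra
open Summit.HubbardSuperconductivity.HubbardSuperconductivity.Theorems.KLRegimeSplit
open Summit.HubbardSuperconductivity.HubbardSuperconductivity.Theorems.KLProgrammeLegKernels

/-! ## §1 Generic: phase-weighted rows ≤ pinned phase-free time-summed kernels, both offset signs -/

section Generic

variable {Lc Lf M : ℕ} [NeZero Lc] [NeZero Lf]

omit [NeZero Lf] in
/-- **The `hdualSp` DEFECT row at one frequency index ≤ the pinned, phase-free, time-summed two-leg defect (both offset signs)** (pins with a common time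
coordinate; second legs matched through the centred lift `ȳ↑ = Torus.proj Lf (Torus.cRep ȳ)`). [cite: BenfattoGiulianiMastropietro2006, §2.4 (2.38)] -/
theorem dualSpDefectRow_le_of_pinnedDefect (Wc : (Fin 2 → SpaceTimeIdx Lc M) → ℂ) (Wf : (Fin 2 → SpaceTimeIdx Lf M) → ℂ) (β : ℝ) (n : MatsubaraIdx M)
    (oc : SpaceTimeIdx Lc M) (of : SpaceTimeIdx Lf M) (ht : of.1 = oc.1) :
    (∑ ybar : TorusSite 2 Lc,
        (‖(∑ t₁ : ImagTimeIdx M, Wc ![oc, (t₁, oc.2 + ybar)] *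
                Complex.exp (((matsubaraFreq β M n * (imagTime β M oc.1 - imagTime β M t₁) : ℝ) : ℂ) * I)) -
            ∑ t₁ : ImagTimeIdx M, Wf ![of, (t₁, of.2 + Torus.proj Lf (Torus.cRep ybar))] *
                Complex.exp (((matsubaraFreq β M n * (imagTime β M of.1 - imagTime β M t₁) : ℝ) : ℂ) * I)‖ +
          ‖(∑ t₁ : ImagTimeIdx M, Wc ![oc, (t₁, oc.2 + -ybar)] *
                Complex.exp (((matsubaraFreq β M n * (imagTime β M oc.1 - imagTime β M t₁) : ℝ) : ℂ) * I)) -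
            ∑ t₁ : ImagTimeIdx M, Wf ![of, (t₁, of.2 + -Torus.proj Lf (Torus.cRep ybar))] *
                Complex.exp (((matsubaraFreq β M n * (imagTime β M of.1 - imagTime β M t₁) : ℝ) : ℂ) * I)‖)) ≤
      ∑ t₁ : ImagTimeIdx M, ∑ ybar : TorusSite 2 Lc,
        (‖Wc ![oc, (t₁, oc.2 + ybar)] - Wf ![of, (t₁, of.2 + Torus.proj Lf (Torus.cRep ybar))]‖ +
          ‖Wc ![oc, (t₁, oc.2 + -ybar)] - Wf ![of, (t₁, of.2 + -Torus.proj Lf (Torus.cRep ybar))]‖) := by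
  rw [sum_comm]
  refine sum_le_sum fun ybar _ => ?_
  rw [sum_add_distrib]
  exact add_le_add (norm_phaseRow_sub_le Wc Wf β n oc of ht _ _) (norm_phaseRow_sub_le Wc Wf β n oc of ht _ _)

/-- **The `hdualSp` FAR row at one frequency index ≤ the pinned, phase-free, time-summed far rows of the fine kernel (both offset signs)**.
[cite: BenfattoGiulianiMastropietro2006, §2.4 (2.38)] -/
theorem dualSpFarRow_le_of_pinned (Wf : (Fin 2 → SpaceTimeIdx Lf M) → ℂ) (β : ℝ) (n : MatsubaraIdx M) (of : SpaceTimeIdx Lf M)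
    (S : Finset (TorusSite 2 Lf)) :
    (∑ y ∈ S,
        (‖∑ t₁ : ImagTimeIdx M, Wf ![of, (t₁, of.2 + y)] *
              Complex.exp (((matsubaraFreq β M n * (imagTime β M of.1 - imagTime β M t₁) : ℝ) : ℂ) * I)‖ +
          ‖∑ t₁ : ImagTimeIdx M, Wf ![of, (t₁, of.2 + -y)] *
              Complex.exp (((matsubaraFreq β M n * (imagTime β M of.1 - imagTime β M t₁) : ℝ) : ℂ) * I)‖)) ≤
      ∑ t₁ : ImagTimeIdx M, ∑ y ∈ S, (‖Wf ![of, (t₁, of.2 + y)]‖ + ‖Wf ![of, (t₁, of.2 + -y)]‖) := by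
  rw [sum_comm]
  refine sum_le_sum fun y _ => ?_
  rw [sum_add_distrib]
  exact add_le_add (norm_phaseRow_le Wf β n of _) (norm_phaseRow_le Wf β n of _)

/-- **The `hdualCut` row through a COMMON comparison value** (two cutoffs = two time grids, so no termwise phase drop): for any `A`,
`‖ε₁R₁ − ε₂R₂‖ ≤ ‖ε₁R₁ − A‖ + ‖A − ε₂R₂‖`, summed over the offsets with both signs. [folklore: triangle] -/
theorem dualCutRow_le_of_common {L : ℕ} [NeZero L] (R₁p R₁m R₂p R₂m Ap Am : TorusSite 2 L → ℂ) (S : Finset (TorusSite 2 L)) :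
    (∑ y ∈ S, (‖R₁p y - R₂p y‖ + ‖R₁m y - R₂m y‖)) ≤
      (∑ y ∈ S, (‖R₁p y - Ap y‖ + ‖R₁m y - Am y‖)) + ∑ y ∈ S, (‖Ap y - R₂p y‖ + ‖Am y - R₂m y‖) := by
  rw [← sum_add_distrib]
  refine sum_le_sum fun y _ => ?_
  have h1 : ‖R₁p y - R₂p y‖ ≤ ‖R₁p y - Ap y‖ + ‖Ap y - R₂p y‖ := norm_sub_le_norm_sub_add_norm_sub _ _ _
  have h2 : ‖R₁m y - R₂m y‖ ≤ ‖R₁m y - Am y‖ + ‖Am y - R₂m y‖ := norm_sub_le_norm_sub_add_norm_sub _ _ _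
  linarith

end Generic

/-! ## §2 Model-keyed: the body of `hdualSp` at given pins from pinned phase-free defect bounds -/

section Model

variable {L₁ L₂ M₂ : ℕ} [NeZero L₁] [NeZero L₂] [NeZero M₂]

/-- **THE BODY OF `hdualSp` AT ONE `(n', L₁, L₂, M₂)` AND GIVEN PINS, FROM PINNED PHASE-FREE TWO-LEG DEFECT BOUNDS** (F-D1 of «(e)-D-ROWS»): with
`W_L σ := sectorisedKernel L M₂ β (trivialMultiplier L M₂) (𝒱_L^{(n')}[K^{(L)}_{n'}] − 𝒩_{K^{(L)}_{n'}}) 2 ((0,σ),0),((0,σ),1))`, pins `oc`, `of` with `of.1 = oc.1`, if for every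
`σ` the time-summed pinned defect through the centred lift (both offset signs) is `≤ Pd σ` and the time-summed far fine rows (both signs) are `≤ Pf σ`, with
`ε·Pd σ ≤ Dd/L₁` and `ε·Pf σ ≤ Df/L₁` (`ε = imagTimeWeight β M₂ ≥ 0`), then the two conjuncts of `hdualSp` hold at these pins for every `m ∈ {ω₀, −ω₀}` and `σ`.
[cite: BenfattoGiulianiMastropietro2006, §2.4 (2.38)] -/
theorem hdualSp_point_of_pinnedDefect {β : ℝ} (hβ : 0 ≤ β) (U μ : ℝ) (n' : ℕ) (oc : SpaceTimeIdx L₁ M₂) (of : SpaceTimeIdx L₂ M₂) (ht : of.1 = oc.1)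
    {Pd Pf : Fin 2 → ℝ} {Dd Df : ℝ}
    (hPd : ∀ σ : Fin 2, ∑ t₁ : ImagTimeIdx M₂, ∑ ybar : TorusSite 2 L₁,
        (‖sectorisedKernel L₁ M₂ β (trivialMultiplier L₁ M₂)
              (klEffectiveAction L₁ M₂ β U μ (klFlowFrameU L₁ M₂ β U μ n') klE0 n' - counterQuadratic L₁ M₂ β (klFlowFrameU L₁ M₂ β U μ n')) 2
              (![((0, σ), 0), ((0, σ), 1)] : Fin 2 → SectorLeg 1) ![oc, (t₁, oc.2 + ybar)] -
            sectorisedKernel L₂ M₂ β (trivialMultiplier L₂ M₂)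
              (klEffectiveAction L₂ M₂ β U μ (klFlowFrameU L₂ M₂ β U μ n') klE0 n' - counterQuadratic L₂ M₂ β (klFlowFrameU L₂ M₂ β U μ n')) 2
              (![((0, σ), 0), ((0, σ), 1)] : Fin 2 → SectorLeg 1) ![of, (t₁, of.2 + Torus.proj L₂ (Torus.cRep ybar))]‖ +
          ‖sectorisedKernel L₁ M₂ β (trivialMultiplier L₁ M₂)
              (klEffectiveAction L₁ M₂ β U μ (klFlowFrameU L₁ M₂ β U μ n') klE0 n' - counterQuadratic L₁ M₂ β (klFlowFrameU L₁ M₂ β U μ n')) 2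
              (![((0, σ), 0), ((0, σ), 1)] : Fin 2 → SectorLeg 1) ![oc, (t₁, oc.2 + -ybar)] -
            sectorisedKernel L₂ M₂ β (trivialMultiplier L₂ M₂)
              (klEffectiveAction L₂ M₂ β U μ (klFlowFrameU L₂ M₂ β U μ n') klE0 n' - counterQuadratic L₂ M₂ β (klFlowFrameU L₂ M₂ β U μ n')) 2
              (![((0, σ), 0), ((0, σ), 1)] : Fin 2 → SectorLeg 1) ![of, (t₁, of.2 + -Torus.proj L₂ (Torus.cRep ybar))]‖) ≤ Pd σ)
    (hPf : ∀ σ : Fin 2, ∑ t₁ : ImagTimeIdx M₂,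
        ∑ y ∈ univ.filter (fun y : TorusSite 2 L₂ => Torus.proj L₂ (Torus.cRep (fun i => (((y i).val : ℕ) : ZMod L₁))) ≠ y),
          (‖sectorisedKernel L₂ M₂ β (trivialMultiplier L₂ M₂)
                (klEffectiveAction L₂ M₂ β U μ (klFlowFrameU L₂ M₂ β U μ n') klE0 n' - counterQuadratic L₂ M₂ β (klFlowFrameU L₂ M₂ β U μ n')) 2
                (![((0, σ), 0), ((0, σ), 1)] : Fin 2 → SectorLeg 1) ![of, (t₁, of.2 + y)]‖ +
            ‖sectorisedKernel L₂ M₂ β (trivialMultiplier L₂ M₂)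
                (klEffectiveAction L₂ M₂ β U μ (klFlowFrameU L₂ M₂ β U μ n') klE0 n' - counterQuadratic L₂ M₂ β (klFlowFrameU L₂ M₂ β U μ n')) 2
                (![((0, σ), 0), ((0, σ), 1)] : Fin 2 → SectorLeg 1) ![of, (t₁, of.2 + -y)]‖) ≤ Pf σ)
    (hDd : ∀ σ, imagTimeWeight β M₂ * Pd σ ≤ Dd / L₁) (hDf : ∀ σ, imagTimeWeight β M₂ * Pf σ ≤ Df / L₁) :
    (∀ m ∈ ({omega0 M₂, (omega0 M₂).rev} : Finset (MatsubaraIdx M₂)), ∀ σ : Fin 2, imagTimeWeight β M₂ * ∑ ybar : TorusSite 2 L₁,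
        (‖(∑ t₁ : ImagTimeIdx M₂,
              sectorisedKernel L₁ M₂ β (trivialMultiplier L₁ M₂)
                  (klEffectiveAction L₁ M₂ β U μ (klFlowFrameU L₁ M₂ β U μ n') klE0 n' - counterQuadratic L₁ M₂ β (klFlowFrameU L₁ M₂ β U μ n')) 2
                  (![((0, σ), 0), ((0, σ), 1)] : Fin 2 → SectorLeg 1) ![oc, (t₁, oc.2 + ybar)] *
                Complex.exp (((matsubaraFreq β M₂ m * (imagTime β M₂ oc.1 - imagTime β M₂ t₁) : ℝ) : ℂ) * I)) -
            (∑ t₁ : ImagTimeIdx M₂,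
              sectorisedKernel L₂ M₂ β (trivialMultiplier L₂ M₂)
                  (klEffectiveAction L₂ M₂ β U μ (klFlowFrameU L₂ M₂ β U μ n') klE0 n' - counterQuadratic L₂ M₂ β (klFlowFrameU L₂ M₂ β U μ n')) 2
                  (![((0, σ), 0), ((0, σ), 1)] : Fin 2 → SectorLeg 1) ![of, (t₁, of.2 + Torus.proj L₂ (Torus.cRep ybar))] *
                Complex.exp (((matsubaraFreq β M₂ m * (imagTime β M₂ of.1 - imagTime β M₂ t₁) : ℝ) : ℂ) * I))‖ +
          ‖(∑ t₁ : ImagTimeIdx M₂,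
              sectorisedKernel L₁ M₂ β (trivialMultiplier L₁ M₂)
                  (klEffectiveAction L₁ M₂ β U μ (klFlowFrameU L₁ M₂ β U μ n') klE0 n' - counterQuadratic L₁ M₂ β (klFlowFrameU L₁ M₂ β U μ n')) 2
                  (![((0, σ), 0), ((0, σ), 1)] : Fin 2 → SectorLeg 1) ![oc, (t₁, oc.2 + -ybar)] *
                Complex.exp (((matsubaraFreq β M₂ m * (imagTime β M₂ oc.1 - imagTime β M₂ t₁) : ℝ) : ℂ) * I)) -
            (∑ t₁ : ImagTimeIdx M₂,
              sectorisedKernel L₂ M₂ β (trivialMultiplier L₂ M₂)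
                  (klEffectiveAction L₂ M₂ β U μ (klFlowFrameU L₂ M₂ β U μ n') klE0 n' - counterQuadratic L₂ M₂ β (klFlowFrameU L₂ M₂ β U μ n')) 2
                  (![((0, σ), 0), ((0, σ), 1)] : Fin 2 → SectorLeg 1) ![of, (t₁, of.2 + -Torus.proj L₂ (Torus.cRep ybar))] *
                Complex.exp (((matsubaraFreq β M₂ m * (imagTime β M₂ of.1 - imagTime β M₂ t₁) : ℝ) : ℂ) * I))‖) ≤ Dd / L₁) ∧
    (∀ m ∈ ({omega0 M₂, (omega0 M₂).rev} : Finset (MatsubaraIdx M₂)), ∀ σ : Fin 2, imagTimeWeight β M₂ *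
        ∑ y ∈ univ.filter (fun y : TorusSite 2 L₂ => Torus.proj L₂ (Torus.cRep (fun i => (((y i).val : ℕ) : ZMod L₁))) ≠ y),
          (‖(∑ t₁ : ImagTimeIdx M₂,
              sectorisedKernel L₂ M₂ β (trivialMultiplier L₂ M₂)
                  (klEffectiveAction L₂ M₂ β U μ (klFlowFrameU L₂ M₂ β U μ n') klE0 n' - counterQuadratic L₂ M₂ β (klFlowFrameU L₂ M₂ β U μ n')) 2
                  (![((0, σ), 0), ((0, σ), 1)] : Fin 2 → SectorLeg 1) ![of, (t₁, of.2 + y)] *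
                Complex.exp (((matsubaraFreq β M₂ m * (imagTime β M₂ of.1 - imagTime β M₂ t₁) : ℝ) : ℂ) * I))‖ +
            ‖(∑ t₁ : ImagTimeIdx M₂,
              sectorisedKernel L₂ M₂ β (trivialMultiplier L₂ M₂)
                  (klEffectiveAction L₂ M₂ β U μ (klFlowFrameU L₂ M₂ β U μ n') klE0 n' - counterQuadratic L₂ M₂ β (klFlowFrameU L₂ M₂ β U μ n')) 2
                  (![((0, σ), 0), ((0, σ), 1)] : Fin 2 → SectorLeg 1) ![of, (t₁, of.2 + -y)] *
                Complex.exp (((matsubaraFreq β M₂ m * (imagTime β M₂ of.1 - imagTime β M₂ t₁) : ℝ) : ℂ) * I))‖) ≤ Df / L₁) := by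
  have hε : 0 ≤ imagTimeWeight β M₂ := imagTimeWeight_nonneg hβ M₂
  refine ⟨fun m _ σ => ?_, fun m _ σ => ?_⟩
  · refine le_trans (mul_le_mul_of_nonneg_left ?_ hε) (hDd σ)
    exact (dualSpDefectRow_le_of_pinnedDefect _ _ β m oc of ht).trans (hPd σ)
  · refine le_trans (mul_le_mul_of_nonneg_left ?_ hε) (hDf σ)
    exact (dualSpFarRow_le_of_pinned _ β m of _).trans (hPf σ)

end Model

end Summit.HubbardSuperconductivity.HubbardSuperconductivity.Theorems.TwoVolumeDefect

end
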